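import Literature.Geometry.Riemannian.KernelNashEntropyJensen
import Literature.Geometry.Riemannian.HeatKernelJointGradientContinuity
import Literature.Geometry.Riemannian.ConjugateHeatTestPairing
import Literature.Geometry.Lorentzian.DalembertianCompose
import HarnessLib

/-!
# `Λ(K(z,σ;y,s)) = −K log K` is a super-solution of the heat equation in the base point
# (Bamler 2020a, §5, the integrand of `□𝒩*_s ≤ 0`; auxiliary file)

R. Bamler, *Entropy and heat kernel bounds on a Ricci flow background*, arXiv:2008.07093 (2020a),
§5, Thm. 5.9: for the conjugate heat kernels `K(x,t;y,s)` of a Ricci flow and `s < t` the pointed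
Nash entropy `𝒩*_s(x, t) = ∫ Λ(K(x,t;y,s)) dg_s(y) − (m/2) log(4π(t − s)) − m/2`,
`Λ(u) = −u log u`, satisfies `□𝒩*_s = −∫ |∇ₓK|²/K dg_s + m/(2(t − s)) ≤ 0`. The integrand of
this computation is the statement that, for each FIXED `(y, s)`, `w_y(z, σ) = Λ(K(z,σ;y,s))` is a
super-solution of the heat equation in the base point:

  `(∂_σ − Δ_{z, g_σ}) Λ(K(z,σ;y,s)) = |∇_z K(z,σ;y,s)|² / K(z,σ;y,s) ≥ 0`

(`∂_σ K = Δ_z K` in the base point, the chain rule `Δ(Λ ∘ K) = Λ''(K)|∇K|² + Λ'(K) ΔK` and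
`Λ''(u) = −1/u`). This file proves it for the tree's kernel `K = hflow.heatKernelFn hh hR` of a
Ricci flow `hflow = (h, cov)` on `[a, T]` of a `C^∞` family of Riemannian metrics on a closed
connected manifold `M` (modelled on `ℝᵐ`), together with its very weak consequence against
the conjugate heat kernel measures `ν_{x,t;σ} = heatKernelMeasure hh hR t x σ`:

* `IsRicciFlow.kernelNashEntropy_eq_integral_negMulLog_sub` — `𝒩*_s(z, σ)` through `Λ`;
* `IsRicciFlow.contMDiffOn_negMulLog_heatKernelFn_basePoint` — `Λ(K)` is smooth in `(z, σ)`;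
* `IsRicciFlow.hasDerivAt_heatKernelFn_baseTime` — `∂_σ K(z,σ;y,s) = Δ_z K` as a `HasDerivAt`;
* `IsRicciFlow.deriv_negMulLog_heatKernelFn_sub_laplaceBeltrami` — the display above;
* `continuousOn_gradSq_div_heatKernelFn_basePoint` — `((z, σ), y) ↦ |∇_z K|²/K` is continuous
  on `(M × (s, T)) × M` (`continuousOn_gradSq_heatKernelFn_basePoint`);
* `IsRicciFlow.integral_negMulLog_heatKernelFn_sub_eq` — pairing with `K(x,t;·,·)`
  (`IsRicciFlow.integral_mul_sub_integral_mul_eq_intervalIntegral`): for `s < σ₁ < σ₂ < t`,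
  `∫ Λ(K(z,σ₂;y,s)) dν_{x,t;σ₂} − ∫ Λ(K(z,σ₁;y,s)) dν_{x,t;σ₁}
    = ∫_{σ₁}^{σ₂} ∫ |∇_z K|²/K (z,σ;y,s) dν_{x,t;σ}(z) dσ`;
* `IsRicciFlow.integrable_negMulLog_heatKernelFn_prod` — integrability of `Λ(K(z,σ;y,s))` on
  `M × M`.

Everything is proved; no definitions, no named facts. What is NOT here: the `y`-integrated
form and the Fisher-information bound that turn this into the first inequality of (5.15)
(`KernelNashEntropySuperharmonic.lean`), and second base-point derivatives of `𝒩*` itself.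

## References

* R. H. Bamler, *Entropy and heat kernel bounds on a Ricci flow background*, arXiv:2008.07093
  (2020), §2.3, §5 Thm. 5.9, §5.4 (5.15). [Bamler2020Entropy]
-/

noncomputable section

open Bundle Set Function Filter Manifold MeasureTheory Measure TopologicalSpace
open scoped Manifold ContDiff Topology ENNReal NNReal

namespace Literature.Geometry.Riemannian

open Lorentzian Lorentzian.PseudoRiemannianMetric

/-! ### Calculus of `Λ(u) = −u log u` -/

/-- `Λ(u) = −u log u` is smooth away from `0`. [folklore] -/
theorem contDiffAt_negMulLog {n : ℕ∞ω} {x : ℝ} (hx : x ≠ 0) :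
    ContDiffAt ℝ n Real.negMulLog x := by
  rw [Real.negMulLog_def]
  exact contDiffAt_id.neg.mul (Real.contDiffAt_log.2 hx)

/-- `Λ''(u) = −1/u`. [folklore] -/
theorem deriv_deriv_negMulLog (x : ℝ) : deriv (deriv Real.negMulLog) x = -x⁻¹ := by
  simpa only [Function.iterate_succ, Function.iterate_zero, Function.id_comp,
    Function.comp_apply] using Real.deriv2_negMulLog x

/-! ### `Λ(K(z,σ;y,s))` is a super-solution of the heat equation in the base point -/

section Generic

variable {m : ℕ} {H : Type*} [TopologicalSpace H]
  {I : ModelWithCorners ℝ (EuclideanSpace ℝ (Fin m)) H} [I.Boundaryless]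
  {M : Type*} [TopologicalSpace M] [ChartedSpace H M] [IsManifold I ∞ M]
  [T2Space M] [CompactSpace M] [SecondCountableTopology M] [MeasurableSpace M] [BorelSpace M]
  [PreconnectedSpace M]
  {h : ℝ → PseudoRiemannianMetric I ∞ (EuclideanSpace ℝ (Fin m)) (TangentSpace I : M → Type _)}
  {cov : ℝ → CovariantDerivative I (EuclideanSpace ℝ (Fin m)) (TangentSpace I : M → Type _)}
  {a T : ℝ} (hflow : IsRicciFlow h cov (Icc a T)) (hh : IsContMDiffFamilyOn ∞ h univ)
  (hR : ∀ r, (h r).IsRiemannian)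

/-- **The pointed Nash entropy of the kernel through `Λ = −u log u`**: for `σ ∈ (a, T]` and
`s ∈ (a, σ)`, `𝒩*_s(z, σ) = ∫ Λ(K(z,σ;y,s)) dg_s(y) − ((m/2) log(4π(σ − s)) + m/2)`.
[cite: Bamler2020Entropy, §5.1, Def. 5.1] -/
theorem IsRicciFlow.kernelNashEntropy_eq_integral_negMulLog_sub {σ : ℝ} (hσ : σ ∈ Ioc a T) (z : M)
    {s : ℝ} (hs : s ∈ Ioo a σ) :
    pointedNashEntropy h (fun r y ↦ hflow.heatKernelFn hh hR σ z (y, r)) m σ s =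
      ∫ y, Real.negMulLog (hflow.heatKernelFn hh hR σ z (y, s)) ∂(h s).riemVolume -
        ((m : ℝ) / 2 * Real.log (4 * Real.pi * (σ - s)) + (m : ℝ) / 2) := by
  rw [hflow.kernelNashEntropy_eq hh hR hσ z hs]
  simp only [Real.negMulLog, neg_mul]
  ring

/-- `Λ(K(z,σ;y,s))` is `C^∞` in the base point `(z, σ) ∈ M × (s, T)` (`K > 0` there and `Λ` is
smooth on `(0, ∞)`). [cite: Bamler2020Entropy, §2.3] -/
theorem IsRicciFlow.contMDiffOn_negMulLog_heatKernelFn_basePoint {s : ℝ} (hs : s ∈ Ioo a T)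
    (y : M) :
    ContMDiffOn (I.prod 𝓘(ℝ, ℝ)) 𝓘(ℝ, ℝ) ∞
      (fun p : M × ℝ ↦ Real.negMulLog (hflow.heatKernelFn hh hR p.2 p.1 (y, s)))
      (univ ×ˢ Ioo s T) := by
  intro p hp
  have hp' : p.2 ∈ Ioo s T := hp.2
  have hpos : 0 < hflow.heatKernelFn hh hR p.2 p.1 (y, s) :=
    hflow.heatKernelFn_pos hh hR ⟨hs.1.trans hp'.1, hp'.2.le⟩ p.1 ⟨mem_univ _, hs.1, hp'.1⟩
  exact (contDiffAt_negMulLog hpos.ne').contMDiffAt.comp_contMDiffWithinAt p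
    (hflow.contMDiffOn_heatKernelFn_basePoint hh hR hs y p hp)

/-- **The heat equation in the base point as a derivative**: for `s ∈ (a, T)`, `σ ∈ (s, T)`,
`σ' ↦ K(z,σ';y,s)` has derivative `Δ_{z,h(σ)} K(·,σ;y,s)(z)` at `σ`
(`IsRicciFlow.deriv_heatKernelFn_basePoint`). [cite: Bamler2020Entropy, §2.3] -/
theorem IsRicciFlow.hasDerivAt_heatKernelFn_baseTime {s : ℝ} (hs : s ∈ Ioo a T) (y : M) {σ : ℝ}
    (hσ : σ ∈ Ioo s T) (z : M) :
    HasDerivAt (fun r ↦ hflow.heatKernelFn hh hR r z (y, s))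
      ((h σ).laplaceBeltrami (fun z' ↦ hflow.heatKernelFn hh hR σ z' (y, s)) z) σ := by
  have hKb := hflow.contMDiffOn_heatKernelFn_basePoint hh hR hs y
  have hO : IsOpen ((univ : Set M) ×ˢ Ioo s T) := isOpen_univ.prod isOpen_Ioo
  have hcurve : ContMDiffAt 𝓘(ℝ, ℝ) 𝓘(ℝ, ℝ) ∞ (fun r ↦ hflow.heatKernelFn hh hR r z (y, s)) σ :=
    (hKb.contMDiffAt (hO.mem_nhds ⟨mem_univ _, hσ⟩)).comp σ
      (contMDiffAt_const.prodMk contMDiffAt_id)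
  have hd : DifferentiableAt ℝ (fun r ↦ hflow.heatKernelFn hh hR r z (y, s)) σ :=
    (contMDiffAt_iff_contDiffAt.1 hcurve).differentiableAt (by simp)
  have h1 := hd.hasDerivAt
  have h2 := hflow.deriv_heatKernelFn_basePoint hh hR hs y (p := (z, σ)) ⟨mem_univ _, hσ⟩
  dsimp only at h2
  rwa [h2] at h1

/-- **`Λ(K)` is a super-solution of the heat equation in the base point, quantitatively**: for
`s ∈ (a, T)`, `σ ∈ (s, T)` and all `z, y`,
`∂_σ Λ(K(z,σ;y,s)) − Δ_{z,h(σ)} Λ(K(·,σ;y,s))(z) = |∇_z K(z,σ;y,s)|²_{h(σ)} / K(z,σ;y,s)`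
(`∂_σ K = Δ_z K`, `Δ(Λ ∘ K) = Λ''(K)|∇K|² + Λ'(K) ΔK`, `Λ''(u) = −1/u`; the integrand of Bamler's
`□𝒩*_s = −∫ |∇K|²/K dg_s + m/(2(σ − s))`). [cite: Bamler2020Entropy, §5, proof of Thm. 5.9] -/
theorem IsRicciFlow.deriv_negMulLog_heatKernelFn_sub_laplaceBeltrami {s : ℝ} (hs : s ∈ Ioo a T)
    (y : M) {σ : ℝ} (hσ : σ ∈ Ioo s T) (z : M) :
    deriv (fun r ↦ Real.negMulLog (hflow.heatKernelFn hh hR r z (y, s))) σ -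
        (h σ).laplaceBeltrami (fun z' ↦ Real.negMulLog (hflow.heatKernelFn hh hR σ z' (y, s))) z =
      (h σ).gradSq (fun z' ↦ hflow.heatKernelFn hh hR σ z' (y, s)) z /
        hflow.heatKernelFn hh hR σ z (y, s) := by
  set u : M → ℝ := fun z' ↦ hflow.heatKernelFn hh hR σ z' (y, s) with hu_def
  have h2le : (2 : ℕ∞ω) ≤ (∞ : ℕ∞ω) := WithTop.coe_le_coe.mpr le_top
  have hσ' : σ ∈ Ioc a T := ⟨hs.1.trans hσ.1, hσ.2.le⟩
  have hpos : 0 < u z := hflow.heatKernelFn_pos hh hR hσ' z ⟨mem_univ _, hs.1, hσ.1⟩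
  have hu : ContMDiff I 𝓘(ℝ, ℝ) ∞ u :=
    contMDiff_slice_of_contMDiffOn (u := fun r z' ↦ hflow.heatKernelFn hh hR r z' (y, s))
      (hflow.contMDiffOn_heatKernelFn_basePoint hh hR hs y) hσ
  have hu2 : ContMDiffAt I 𝓘(ℝ, ℝ) 2 u z := (hu.of_le h2le).contMDiffAt
  have hΛ2 : ContDiffAt ℝ 2 Real.negMulLog (u z) := contDiffAt_negMulLog hpos.ne'
  have hdΛ : HasDerivAt (fun r ↦ Real.negMulLog (hflow.heatKernelFn hh hR r z (y, s)))
      ((-Real.log (u z) - 1) * (h σ).laplaceBeltrami u z) σ := by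
    have h0 := (Real.hasDerivAt_negMulLog hpos.ne').comp σ
      (hflow.hasDerivAt_heatKernelFn_baseTime hh hR hs y hσ z)
    exact h0
  rw [hdΛ.deriv]
  haveI := (h σ).hasLeviCivita
  have hcomp : (fun z' ↦ Real.negMulLog (hflow.heatKernelFn hh hR σ z' (y, s))) =
      Real.negMulLog ∘ u := rfl
  rw [hcomp, laplaceBeltrami_eq_dalembertian (h σ) (Real.negMulLog ∘ u) z,
    (h σ).dalembertian_real_comp hu2 hΛ2, ← laplaceBeltrami_eq_dalembertian,
    deriv_deriv_negMulLog, Real.deriv_negMulLog hpos.ne']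
  simp only [PseudoRiemannianMetric.gradSq, div_eq_mul_inv]
  ring

/-- **Joint continuity of `|∇_z K|²/K`** on `(M × (s, T)) × M`
(`continuousOn_gradSq_heatKernelFn_basePoint`, continuity and positivity of `K`).
[cite: Bamler2020Entropy, §2.3] -/
theorem continuousOn_gradSq_div_heatKernelFn_basePoint {s : ℝ} (hs : s ∈ Ioo a T) :
    ContinuousOn (fun q : (M × ℝ) × M ↦
        (h q.1.2).gradSq (fun z ↦ hflow.heatKernelFn hh hR q.1.2 z (q.2, s)) q.1.1 /
          hflow.heatKernelFn hh hR q.1.2 q.1.1 (q.2, s))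
      ((univ ×ˢ Ioo s T) ×ˢ univ) := by
  refine (continuousOn_gradSq_heatKernelFn_basePoint hflow hh hR hs).div
    ((hflow.continuousOn_heatKernelFn_basePoint hh hR hs).mono
      (prod_mono (prod_mono le_rfl Ioo_subset_Ioc_self) le_rfl)) fun q hq ↦ ?_
  exact (hflow.heatKernelFn_pos hh hR ⟨hs.1.trans hq.1.2.1, hq.1.2.2.le⟩ q.1.1
    ⟨mem_univ _, hs.1, hq.1.2.1⟩).ne'

/-- **Pairing `Λ(K(·,·;y,s))` with the conjugate heat kernel measures** (the very weak form of
`□* K(x,t;·,·) = 0` applied to the super-solution `w_y = Λ(K(·,·;y,s))`): for `t ∈ (a, T]`,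
`a < s < σ₁ < σ₂ < t` and every `y`,
`∫ Λ(K(z,σ₂;y,s)) dν_{x,t;σ₂}(z) − ∫ Λ(K(z,σ₁;y,s)) dν_{x,t;σ₁}(z)
  = ∫_{σ₁}^{σ₂} ∫ |∇_z K(z,σ;y,s)|²/K(z,σ;y,s) dν_{x,t;σ}(z) dσ`
(`IsRicciFlow.integral_mul_sub_integral_mul_eq_intervalIntegral` and
`IsRicciFlow.deriv_negMulLog_heatKernelFn_sub_laplaceBeltrami`).
[cite: Bamler2020Entropy, §5, proof of Thm. 5.9 / (5.15)] -/
theorem IsRicciFlow.integral_negMulLog_heatKernelFn_sub_eq {t : ℝ} (ht : t ∈ Ioc a T) (x : M)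
    {s σ₁ σ₂ : ℝ} (has : a < s) (hs₁ : s < σ₁) (h12 : σ₁ < σ₂) (hσ₂t : σ₂ < t) (y : M) :
    ∫ z, Real.negMulLog (hflow.heatKernelFn hh hR σ₂ z (y, s)) ∂(heatKernelMeasure hh hR t x σ₂) -
        ∫ z, Real.negMulLog (hflow.heatKernelFn hh hR σ₁ z (y, s))
          ∂(heatKernelMeasure hh hR t x σ₁) =
      ∫ σ in σ₁..σ₂, ∫ z, (h σ).gradSq (fun z' ↦ hflow.heatKernelFn hh hR σ z' (y, s)) z /
        hflow.heatKernelFn hh hR σ z (y, s) ∂(heatKernelMeasure hh hR t x σ) := by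
  have hsT : s ∈ Ioo a T := ⟨has, ((hs₁.trans h12).trans hσ₂t).trans_le ht.2⟩
  have hsub : Icc σ₁ σ₂ ⊆ Ioo s T := fun r hr ↦
    ⟨hs₁.trans_le hr.1, (hr.2.trans_lt hσ₂t).trans_le ht.2⟩
  have hw : ContMDiffOn (I.prod 𝓘(ℝ, ℝ)) 𝓘(ℝ, ℝ) ∞
      (fun p : M × ℝ ↦ Real.negMulLog (hflow.heatKernelFn hh hR p.2 p.1 (y, s)))
      (univ ×ˢ Icc σ₁ σ₂) :=
    (hflow.contMDiffOn_negMulLog_heatKernelFn_basePoint hh hR hsT y).mono (prod_mono le_rfl hsub)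
  have hsol : IsConjugateHeatSolutionOn h cov (Icc σ₁ σ₂)
      fun r z ↦ hflow.heatKernelFn hh hR t x (z, r) :=
    isConjugateHeatSolutionOn_of_kernel (hflow.heatKernelFn_contMDiffOn hh hR ht x)
      (fun p hp ↦ hflow.deriv_heatKernelFn_time hh hR ht x hp) (has.trans hs₁) h12 hσ₂t
  have hflow' : IsRicciFlow h cov (Icc σ₁ σ₂) :=
    hflow.mono (Icc_subset_Icc (has.trans hs₁).le (hσ₂t.le.trans ht.2))
  have key := hflow'.integral_mul_sub_integral_mul_eq_intervalIntegral h12 (fun r _ ↦ hR r)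
    (ζ := fun r z ↦ Real.negMulLog (hflow.heatKernelFn hh hR r z (y, s))) hw hsol
  rw [hflow.integral_heatKernelMeasure_eq_integral_mul_heatKernelFn hh hR ht x
      ⟨(has.trans hs₁).trans h12, hσ₂t⟩,
    hflow.integral_heatKernelMeasure_eq_integral_mul_heatKernelFn hh hR ht x
      ⟨has.trans hs₁, h12.trans hσ₂t⟩, key]
  refine intervalIntegral.integral_congr fun σ hσ ↦ ?_
  rw [uIcc_of_le h12.le] at hσ
  have hσ' : σ ∈ Ioo s T := hsub hσ
  rw [hflow.integral_heatKernelMeasure_eq_integral_mul_heatKernelFn hh hR ht x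
      ⟨(has.trans hs₁).trans_le hσ.1, hσ.2.trans_lt hσ₂t⟩]
  refine integral_congr_ae (Eventually.of_forall fun z ↦ ?_)
  dsimp only
  have hpos : 0 < hflow.heatKernelFn hh hR σ z (y, s) :=
    hflow.heatKernelFn_pos hh hR ⟨hsT.1.trans hσ'.1, hσ'.2.le⟩ z ⟨mem_univ _, hsT.1, hσ'.1⟩
  have hd : DifferentiableAt ℝ
      (fun r ↦ Real.negMulLog (hflow.heatKernelFn hh hR r z (y, s))) σ := by
    have h0 := ((Real.hasDerivAt_negMulLog hpos.ne').comp σ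
      (hflow.hasDerivAt_heatKernelFn_baseTime hh hR hsT y hσ' z)).differentiableAt
    exact h0
  congr 1
  rw [hd.derivWithin (uniqueDiffOn_Icc h12 σ hσ)]
  exact hflow.deriv_negMulLog_heatKernelFn_sub_laplaceBeltrami hh hR hsT y hσ' z

/-- `(z, y) ↦ Λ(K(z,σ;y,s))` is integrable on `M × M` against `ν ⊗ g_s` for every finite measure
`ν` (it is continuous on the compact `M × M`). [cite: Bamler2020Entropy, §5.1] -/
theorem IsRicciFlow.integrable_negMulLog_heatKernelFn_prod (ν : Measure M) [IsFiniteMeasure ν]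
    {s σ : ℝ} (has : a < s) (hsσ : s < σ) (hσT : σ ≤ T) :
    Integrable (uncurry fun z y ↦ Real.negMulLog (hflow.heatKernelFn hh hR σ z (y, s)))
      (ν.prod (h s).riemVolume) := by
  haveI : IsFiniteMeasure (h s).riemVolume := ⟨(h s).riemVolume_univ_lt_top⟩
  have hΛc : Continuous (uncurry fun z y ↦
      Real.negMulLog (hflow.heatKernelFn hh hR σ z (y, s))) :=
    Real.continuous_negMulLog.comp (hflow.continuous_heatKernelFn_basePoint_target hh hR
      ⟨has.trans hsσ, hσT⟩ ⟨has, hsσ⟩)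
  exact hΛc.integrable_of_hasCompactSupport (HasCompactSupport.of_compactSpace _)

end Generic

end Literature.Geometry.Riemannian

end
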